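import Mathlib.LinearAlgebra.BilinearForm.Orthogonal
import HarnessLib

/-!
# Lagrangian descent of a self-orthogonal local condition (pure linear algebra behind `ARCH-NETTING`, crux
# stmt-BirchSwinnertonDyer-22298 `MainConjectureOfRankZeroBSDAtTwo`, route `AlignedTransportAtTwo`, road (b″))

HONEST FRAMING (cell `bsd-f1-sign2`, lead prover seat `bsd-line-att-p2` gen 3; BSD is NOT proved by any of this). THEOREMS ONLY,
pure Mathlib linear algebra, no arithmetic input, nothing asserted. This is the kernel form of the «consistency check» of the
crux workfile `Cruxes/MainConjectureOfRankZeroBSDAtTwo/ARCH-NETTING.md`.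

SETTING. A finite-dimensional `K`-space `V₂ × Vᵣ` with a nondegenerate reflexive bilinear form `B = B₂ ⊞ Bᵣ` (orthogonal sum),
a LAGRANGIAN `I ≤ V₂ × Vᵣ` (`I^⊥ = I`; model: the image of `H¹(G_Σ(ℚ_n), E[2^k])` in `⊕_{v ∈ Σ} H¹(ℚ_{n,v}, E[2^k])`,
self-orthogonal by Poitou–Tate for the self-dual `E[2^k]`, `V₂` = the local group at `2` (and the bad primes), `Vᵣ` = the sum
over the `2ⁿ` real places) and a «local condition» `W ≤ V₂`. The REALISATION of `W` in `Vᵣ` is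
`S(W) := snd(I ⊓ (W × Vᵣ)) ≤ Vᵣ` (model: the real components realised by Selmer classes with condition `W` at `2`).

RESULTS. `orthogonal_realisation`: `S(W)^⊥ = S(W^⊥)`. Hence (`realisation_isLagrangian_of_self_orthogonal`) a
SELF-ORTHOGONAL condition `W = W^⊥` (model: the ordinary condition at `2`, self-dual under local Tate duality) realises a
LAGRANGIAN of `Vᵣ` — exactly half: `2·dim S(W) = dim Vᵣ` (`two_mul_finrank_realisation`) — which in the model is the
statement «the relaxed-at-∞ / strict-at-∞ quotient of the ordinary Selmer group over `ℚ_n` has `𝔽₂`-dimension `2ⁿ`»,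
i.e. Greenberg's `(Λ/2)^{[Δ_E>0]}` (LNM 1716 §4) at finite level WITHOUT a cotorsion hypothesis; and the fine (`W = 0`) and
relaxed-at-`2` (`W = ⊤`) realisations are mutual annihilators (`orthogonal_realisation_bot`).

References: B. Poonen, E. Rains, *Random maximal isotropic subspaces and Selmer groups*, JAMS 25 (2012), §4 (the Selmer
group as an intersection of Lagrangians); R. Greenberg, LNM 1716 (1999), §4 (the archimedean factor at `p = 2`).
-/

set_option linter.dupNamespace false
set_option autoImplicit false

namespace Summit.BirchSwinnertonDyer.BirchSwinnertonDyer.Theorems.AlignedTransportAtTwoLagrangianDescent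

open LinearMap (BilinForm)
open Module

variable {K : Type*} [Field K] {V₂ Vᵣ : Type*} [AddCommGroup V₂] [Module K V₂] [AddCommGroup Vᵣ] [Module K Vᵣ]

/-! ## §1 Orthogonals of sums, intersections and products -/

/-- `(A ⊔ C)^⊥ = A^⊥ ⊓ C^⊥` for any bilinear form. [folklore] -/
theorem orthogonal_sup {M : Type*} [AddCommGroup M] [Module K M] (B : BilinForm K M) (A C : Submodule K M) :
    B.orthogonal (A ⊔ C) = B.orthogonal A ⊓ B.orthogonal C := by
  apply le_antisymm
  · exact le_inf (B.orthogonal_le le_sup_left) (B.orthogonal_le le_sup_right)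
  · intro m hm
    rw [Submodule.mem_inf, LinearMap.BilinForm.mem_orthogonal_iff, LinearMap.BilinForm.mem_orthogonal_iff] at hm
    rw [LinearMap.BilinForm.mem_orthogonal_iff]
    intro n hn
    obtain ⟨a, ha, c, hc, rfl⟩ := Submodule.mem_sup.mp hn
    rw [LinearMap.BilinForm.add_left, hm.1 a ha, hm.2 c hc, add_zero]

/-- `(A ⊓ C)^⊥ = A^⊥ ⊔ C^⊥` for a nondegenerate reflexive form on a finite-dimensional space (double orthogonal).
[folklore] -/
theorem orthogonal_inf {M : Type*} [AddCommGroup M] [Module K M] [FiniteDimensional K M] {B : BilinForm K M}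
    (hB : B.Nondegenerate) (hBr : B.IsRefl) (A C : Submodule K M) :
    B.orthogonal (A ⊓ C) = B.orthogonal A ⊔ B.orthogonal C := by
  have h : A ⊓ C = B.orthogonal (B.orthogonal A ⊔ B.orthogonal C) := by
    rw [orthogonal_sup, LinearMap.BilinForm.orthogonal_orthogonal hB hBr,
      LinearMap.BilinForm.orthogonal_orthogonal hB hBr]
  rw [h, LinearMap.BilinForm.orthogonal_orthogonal hB hBr]

section Product

variable (B₂ : BilinForm K V₂) (Bᵣ : BilinForm K Vᵣ) (B : BilinForm K (V₂ × Vᵣ))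
  (hform : ∀ u v : V₂ × Vᵣ, B u v = B₂ u.1 v.1 + Bᵣ u.2 v.2)

include hform

/-- `B₂` is a corner of the orthogonal sum: `B₂ x x' = B (x,0) (x',0)`. [folklore] -/
theorem left_apply (x x' : V₂) : B₂ x x' = B (x, 0) (x', 0) := by
  rw [hform]; simp

/-- `Bᵣ` is a corner of the orthogonal sum: `Bᵣ y y' = B (0,y) (0,y')`. [folklore] -/
theorem right_apply (y y' : Vᵣ) : Bᵣ y y' = B (0, y) (0, y') := by
  rw [hform]; simp

/-- Reflexivity descends to the corner `B₂`. [folklore] -/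
theorem isRefl_left (hBr : B.IsRefl) : B₂.IsRefl := fun x x' h => by
  rw [left_apply B₂ Bᵣ B hform] at h ⊢
  exact hBr _ _ h

/-- Reflexivity descends to the corner `Bᵣ`. [folklore] -/
theorem isRefl_right (hBr : B.IsRefl) : Bᵣ.IsRefl := fun y y' h => by
  rw [right_apply B₂ Bᵣ B hform] at h ⊢
  exact hBr _ _ h

/-- Nondegeneracy descends to the corner `B₂`. [folklore] -/
theorem nondegenerate_left (hB : B.Nondegenerate) : B₂.Nondegenerate := by
  refine ⟨fun x hx => ?_, fun x hx => ?_⟩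
  · have h0 : ((x, 0) : V₂ × Vᵣ) = 0 := hB.1 (x, 0) fun v => by
      rw [hform]; simp [hx v.1]
    exact (Prod.mk_eq_zero.mp h0).1
  · have h0 : ((x, 0) : V₂ × Vᵣ) = 0 := hB.2 (x, 0) fun v => by
      rw [hform]; simp [hx v.1]
    exact (Prod.mk_eq_zero.mp h0).1

/-- Nondegeneracy descends to the corner `Bᵣ`. [folklore] -/
theorem nondegenerate_right (hB : B.Nondegenerate) : Bᵣ.Nondegenerate := by
  refine ⟨fun y hy => ?_, fun y hy => ?_⟩
  · have h0 : ((0, y) : V₂ × Vᵣ) = 0 := hB.1 (0, y) fun v => by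
      rw [hform]; simp [hy v.2]
    exact (Prod.mk_eq_zero.mp h0).2
  · have h0 : ((0, y) : V₂ × Vᵣ) = 0 := hB.2 (0, y) fun v => by
      rw [hform]; simp [hy v.2]
    exact (Prod.mk_eq_zero.mp h0).2

/-- Orthogonal of a product subspace: `(W × W')^⊥ = W^⊥ × W'^⊥` for the orthogonal sum form. [folklore] -/
theorem orthogonal_prod (W : Submodule K V₂) (W' : Submodule K Vᵣ) :
    B.orthogonal (W.prod W') = (B₂.orthogonal W).prod (Bᵣ.orthogonal W') := by
  ext ⟨x, y⟩
  simp only [LinearMap.BilinForm.mem_orthogonal_iff, Submodule.mem_prod]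
  constructor
  · intro h
    refine ⟨fun w hw => ?_, fun w' hw' => ?_⟩
    · have := h (w, 0) ⟨hw, Submodule.zero_mem _⟩
      rw [hform] at this; simpa using this
    · have := h (0, w') ⟨Submodule.zero_mem _, hw'⟩
      rw [hform] at this; simpa using this
  · rintro ⟨h₂, hr⟩ ⟨w, w'⟩ ⟨hw, hw'⟩
    rw [hform]
    simp [h₂ w hw, hr w' hw']

/-! ## §2 The realisation `S(W) = snd(I ⊓ (W × Vᵣ))` and its orthogonal -/

/-- **`S(W)^⊥ ⊇ S(W^⊥)`** — the easy inclusion, for any `I` with `I ≤ I^⊥` (isotropic). [folklore] -/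
theorem realisation_orthogonal_le (I : Submodule K (V₂ × Vᵣ)) (hI : I ≤ B.orthogonal I) (W : Submodule K V₂) :
    Submodule.map (LinearMap.snd K V₂ Vᵣ) (I ⊓ (B₂.orthogonal W).prod ⊤) ≤
      Bᵣ.orthogonal (Submodule.map (LinearMap.snd K V₂ Vᵣ) (I ⊓ W.prod ⊤)) := by
  rintro y ⟨i, ⟨hiI, hiW, -⟩, rfl⟩
  rw [LinearMap.BilinForm.mem_orthogonal_iff]
  rintro z ⟨j, ⟨hjI, hjW, -⟩, rfl⟩
  have hji : B j i = 0 := hI hiI j hjI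
  have h21 : B₂ j.1 i.1 = 0 := hiW j.1 hjW
  rw [hform, h21, zero_add] at hji
  exact hji

/-- **`S(W)^⊥ = S(W^⊥)`: the realisation in `Vᵣ` of a local condition `W ≤ V₂` through a LAGRANGIAN `I` (`I^⊥ = I`) of
the orthogonal sum `V₂ ⊞ Vᵣ` has orthogonal equal to the realisation of `W^⊥`.** (Proof: `y ⊥ S(W)` iff
`(0,y) ∈ (I ⊓ (W × Vᵣ))^⊥ = I^⊥ + (W × Vᵣ)^⊥ = I + (W^⊥ × 0)`.) [cite: PoonenRains2012, §4 (Selmer groups as intersections of maximal isotropic subspaces)] -/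
theorem orthogonal_realisation [FiniteDimensional K V₂] [FiniteDimensional K Vᵣ] (hB : B.Nondegenerate)
    (hBr : B.IsRefl) (I : Submodule K (V₂ × Vᵣ)) (hI : B.orthogonal I = I) (W : Submodule K V₂) :
    Bᵣ.orthogonal (Submodule.map (LinearMap.snd K V₂ Vᵣ) (I ⊓ W.prod ⊤)) =
      Submodule.map (LinearMap.snd K V₂ Vᵣ) (I ⊓ (B₂.orthogonal W).prod ⊤) := by
  apply le_antisymm _ (realisation_orthogonal_le B₂ Bᵣ B hform I hI.ge W)
  intro y hy
  rw [LinearMap.BilinForm.mem_orthogonal_iff] at hy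
  -- `(0, y) ∈ (I ⊓ (W × ⊤))^⊥`
  have h1 : ((0 : V₂), y) ∈ B.orthogonal (I ⊓ W.prod ⊤) := by
    rw [LinearMap.BilinForm.mem_orthogonal_iff]
    rintro j ⟨hjI, hjW, -⟩
    rw [hform]
    simp only [map_zero, zero_add]
    exact hy j.2 ⟨j, ⟨hjI, hjW, Submodule.mem_top⟩, rfl⟩
  -- `(I ⊓ (W × ⊤))^⊥ = I ⊔ (W^⊥ × ⊥)`
  have hB₂ : B₂.Nondegenerate := nondegenerate_left B₂ Bᵣ B hform hB
  have hB₂r : B₂.IsRefl := isRefl_left B₂ Bᵣ B hform hBr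
  have hBᵣ : Bᵣ.Nondegenerate := nondegenerate_right B₂ Bᵣ B hform hB
  have h2 : B.orthogonal (I ⊓ W.prod ⊤) = I ⊔ (B₂.orthogonal W).prod ⊥ := by
    rw [orthogonal_inf hB hBr, hI, orthogonal_prod B₂ Bᵣ B hform,
      LinearMap.BilinForm.orthogonal_top_eq_bot hBᵣ]
  rw [h2] at h1
  obtain ⟨i, hiI, w, hw, hsum⟩ := Submodule.mem_sup.mp h1
  obtain ⟨hw1, hw2⟩ := Submodule.mem_prod.mp hw
  have hw2' : w.2 = 0 := (Submodule.mem_bot K).mp hw2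
  refine ⟨i, ⟨hiI, ?_, Submodule.mem_top⟩, ?_⟩
  · -- `i.1 = -w.1 ∈ W^⊥`
    have hi1 : i.1 = -w.1 := by
      have := congrArg Prod.fst hsum
      simp only [Prod.fst_add] at this
      exact eq_neg_of_add_eq_zero_left this
    change i.1 ∈ B₂.orthogonal W
    rw [hi1]
    exact Submodule.neg_mem _ hw1
  · have := congrArg Prod.snd hsum
    simp only [Prod.snd_add, hw2', add_zero] at this
    exact this

/-- **A self-orthogonal local condition realises a LAGRANGIAN**: if `W^⊥ = W` then `S(W)^⊥ = S(W)`. (Model: the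
ordinary condition at `2` is its own annihilator under local Tate duality, so the real components realised by the
ordinary Selmer group over `ℚ_n` form a maximal isotropic subspace of `⊕_{v real} H¹(ℝ, E[2^k])`.)
[cite: PoonenRains2012, §4] [cite: GreenbergLNM1716, §4 (archimedean factor at p = 2)] -/
theorem realisation_isLagrangian_of_self_orthogonal [FiniteDimensional K V₂] [FiniteDimensional K Vᵣ]
    (hB : B.Nondegenerate) (hBr : B.IsRefl) (I : Submodule K (V₂ × Vᵣ)) (hI : B.orthogonal I = I)
    (W : Submodule K V₂) (hW : B₂.orthogonal W = W) :
    Bᵣ.orthogonal (Submodule.map (LinearMap.snd K V₂ Vᵣ) (I ⊓ W.prod ⊤)) =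
      Submodule.map (LinearMap.snd K V₂ Vᵣ) (I ⊓ W.prod ⊤) := by
  rw [orthogonal_realisation B₂ Bᵣ B hform hB hBr I hI W, hW]

/-- **Exactly half**: for a self-orthogonal `W`, `2 · dim S(W) = dim Vᵣ`. (Model: the relaxed-at-∞ / strict-at-∞
quotient of the ordinary Selmer group of `E[2^k]` over the `n`-th cyclotomic layer `ℚ_n` has `𝔽₂`-dimension `2ⁿ` when
`Δ_E > 0`, where `dim ⊕_{v real} H¹(ℝ, E[2^k]) = 2·2ⁿ` — Greenberg's `(Λ/2)` at finite level, with no cotorsion hypothesis.)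
[cite: GreenbergLNM1716, §4 (archimedean factor at p = 2)] -/
theorem two_mul_finrank_realisation [FiniteDimensional K V₂] [FiniteDimensional K Vᵣ]
    (hB : B.Nondegenerate) (hBr : B.IsRefl) (I : Submodule K (V₂ × Vᵣ)) (hI : B.orthogonal I = I)
    (W : Submodule K V₂) (hW : B₂.orthogonal W = W) :
    2 * finrank K (Submodule.map (LinearMap.snd K V₂ Vᵣ) (I ⊓ W.prod ⊤)) = finrank K Vᵣ := by
  have hBᵣ : Bᵣ.Nondegenerate := nondegenerate_right B₂ Bᵣ B hform hB
  have h := LinearMap.BilinForm.finrank_orthogonal hBᵣ (Submodule.map (LinearMap.snd K V₂ Vᵣ) (I ⊓ W.prod ⊤))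
  rw [realisation_isLagrangian_of_self_orthogonal B₂ Bᵣ B hform hB hBr I hI W hW] at h
  have hle : finrank K (Submodule.map (LinearMap.snd K V₂ Vᵣ) (I ⊓ W.prod ⊤)) ≤ finrank K Vᵣ :=
    Submodule.finrank_le _
  omega

/-- **Fine versus relaxed-at-`2` are mutual annihilators**: `S(⊥)^⊥ = S(⊤)` — the real components realised by
classes TRIVIAL at `2` (fine) annihilate exactly those realised by classes with NO condition at `2`, so
`dim S(⊥) + dim S(⊤) = dim Vᵣ`. [cite: PoonenRains2012, §4] -/
theorem orthogonal_realisation_bot [FiniteDimensional K V₂] [FiniteDimensional K Vᵣ] (hB : B.Nondegenerate)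
    (hBr : B.IsRefl) (I : Submodule K (V₂ × Vᵣ)) (hI : B.orthogonal I = I) :
    Bᵣ.orthogonal (Submodule.map (LinearMap.snd K V₂ Vᵣ) (I ⊓ (⊥ : Submodule K V₂).prod ⊤)) =
      Submodule.map (LinearMap.snd K V₂ Vᵣ) (I ⊓ (⊤ : Submodule K V₂).prod ⊤) := by
  rw [orthogonal_realisation B₂ Bᵣ B hform hB hBr I hI ⊥, LinearMap.BilinForm.orthogonal_bot]

/-- The dimension count for fine versus relaxed-at-`2`: `dim S(⊥) + dim S(⊤) = dim Vᵣ`. [cite: PoonenRains2012, §4] -/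
theorem finrank_realisation_bot_add_top [FiniteDimensional K V₂] [FiniteDimensional K Vᵣ] (hB : B.Nondegenerate)
    (hBr : B.IsRefl) (I : Submodule K (V₂ × Vᵣ)) (hI : B.orthogonal I = I) :
    finrank K (Submodule.map (LinearMap.snd K V₂ Vᵣ) (I ⊓ (⊥ : Submodule K V₂).prod ⊤)) +
      finrank K (Submodule.map (LinearMap.snd K V₂ Vᵣ) (I ⊓ (⊤ : Submodule K V₂).prod ⊤)) = finrank K Vᵣ := by
  have hBᵣ : Bᵣ.Nondegenerate := nondegenerate_right B₂ Bᵣ B hform hB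
  have h := LinearMap.BilinForm.finrank_orthogonal hBᵣ
    (Submodule.map (LinearMap.snd K V₂ Vᵣ) (I ⊓ (⊥ : Submodule K V₂).prod ⊤))
  rw [orthogonal_realisation_bot B₂ Bᵣ B hform hB hBr I hI] at h
  have hle : finrank K (Submodule.map (LinearMap.snd K V₂ Vᵣ) (I ⊓ (⊥ : Submodule K V₂).prod ⊤)) ≤
      finrank K Vᵣ := Submodule.finrank_le _
  omega

end Product

end Summit.BirchSwinnertonDyer.BirchSwinnertonDyer.Theorems.AlignedTransportAtTwoLagrangianDescent
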